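import Summits.AtomisticToContinuum.BoseEinsteinCondensation.Theorems.BECGroundStateSOSPeriodicIRBoundTwoSectorFloatingDefs
import Summits.AtomisticToContinuum.BoseEinsteinCondensation.Theorems.BECGroundStateSOSPeriodicIRBoundWFAssembly
import Summits.AtomisticToContinuum.BoseEinsteinCondensation.Theorems.BECGroundStateSOSPeriodicIRBoundZeroMomentumGapIntegrable
import HarnessLib

/-!
# Route `BECGroundStateSOS`, crux `PeriodicIRBound` (stmt-AtomisticToContinuum-3972), line `two-sector-gd-transfer`
# (v8) — stub `stub_momentumZeroReduction` (normal form: momentum-zero near-minimisers suffice)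

Supports (does not close) stmt-AtomisticToContinuum-3972. For ONE integrable admissible pair potential `v` it
suffices to prove the crux's infrared inequality `n_k(Ψ) ≤ C√ρ L_N/‖k‖_∞` for near-minimisers `Ψ` of TOTAL MOMENTUM
ZERO (translation-invariant `Ψ`), at the cost of a factor `2` in the constant: `IRBoundWith v κ ρ₀ (2C)`.

Proof (the near-minimiser decomposition of `WF.wagnerFeynmanWith_two`). At fixed `(N, L) = (n+1, L_N(ρ))` write a
`δ`-near-minimiser as `ψ = Φ + Ψ⊥` with `Φ := PΨ` the centre-of-mass projection (`WF.comProj`, a core function of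
total momentum `0`, `WF.isCore_comProj`) and `Ψ⊥ := ψ − Φ`; Pythagoras `‖ψ‖² = ‖Φ‖² + ‖Ψ⊥‖²`,
`𝓔[ψ] = 𝓔[Φ] + 𝓔[Ψ⊥]` (`WF.comProj_pythagoras`), the variational bound `E₀‖Φ‖² ≤ 𝓔[Φ]` and the complement gap
`(E₀ + g)‖Ψ⊥‖² ≤ 𝓔[Ψ⊥]` (`WF.exists_gap_comProj`, from the landed zero-momentum gap
`zeroMomentumGapFor_of_integrable`) give `g‖Ψ⊥‖² ≤ δ` and `𝓔[Φ] ≤ E₀‖Φ‖² + δ`. For `δ ≤ g/4` the normalised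
projection `Φ/‖Φ‖` is a momentum-zero `2δ`-near-minimiser, so the hypothesis bounds `n_k(Φ) ≤ ‖Φ‖² · CX ≤ CX`
(`X := √ρ L/‖k‖`, `WF.cellOccupation_const_mul`), while `n_k(Ψ⊥) ≤ N‖Ψ⊥‖² ≤ Nδ/g`
(`WF.cellOccupation_le_mul_normSq`); Minkowski (`WF.normSq_add_le_sq`, `a_k` additive) gives
`n_k(ψ) ≤ (√n_k(Φ) + √n_k(Ψ⊥))² ≤ (3/2) n_k(Φ) + 3 n_k(Ψ⊥) ≤ 2CX` once `6Nδ/g ≤ C/κ ≤ CX` on the window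
`‖k‖ ≤ κ√ρL`. Elementary given the landed `WF` toolkit; nothing is cited as a fact.
-/

noncomputable section

open scoped BigOperators ENNReal ComplexConjugate
open Filter MeasureTheory

namespace Summit.AtomisticToContinuum.BoseEinsteinCondensation.Cruxes.PeriodicIRBound.TwoSectorGdTransfer

open Literature.MathematicalPhysics.QuantumManyBody.BoseGas
open Summit.AtomisticToContinuum.BoseEinsteinCondensation.Theorems.PeriodicIRBound.Negative
  (NearMin InWindow IRIneq IRBoundWith irIneq_iff)
open Summit.AtomisticToContinuum.BoseEinsteinCondensation.Cruxes.PeriodicIRBound.LinearPhFloorWagner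
  (zeroMomentumGapFor_of_integrable periodicGroundStateEnergy_integrable_ne_top)
open Summit.AtomisticToContinuum.BoseEinsteinCondensation.Cruxes.PeriodicIRBound.LinearPhFloorWagner.WF

namespace MomentumZero

variable {n : ℕ} {L : ℝ}

/-- `(a^{1/2} + b^{1/2})² = ofReal ((√a + √b)²)` for finite `a, b`. [folklore] -/
theorem rpow_half_add_sq_eq {a b : ℝ≥0∞} (ha : a ≠ ⊤) (hb : b ≠ ⊤) :
    (a ^ (1 / 2 : ℝ) + b ^ (1 / 2 : ℝ)) ^ (2 : ℝ) =
      ENNReal.ofReal ((Real.sqrt a.toReal + Real.sqrt b.toReal) ^ 2) := by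
  have ha' : a ^ (1 / 2 : ℝ) ≠ ⊤ := ENNReal.rpow_ne_top_of_nonneg (by norm_num) ha
  have hb' : b ^ (1 / 2 : ℝ) ≠ ⊤ := ENNReal.rpow_ne_top_of_nonneg (by norm_num) hb
  have hs : a ^ (1 / 2 : ℝ) + b ^ (1 / 2 : ℝ) ≠ ⊤ := ENNReal.add_ne_top.2 ⟨ha', hb'⟩
  rw [← ENNReal.ofReal_toReal (ENNReal.rpow_ne_top_of_nonneg (by norm_num) hs), ← ENNReal.toReal_rpow,
    ENNReal.toReal_add ha' hb', ← ENNReal.toReal_rpow, ← ENNReal.toReal_rpow, ← Real.sqrt_eq_rpow,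
    ← Real.sqrt_eq_rpow, Real.rpow_two]

/-- **The transfer at fixed `(N, L) = (n+1, L)`.** If every momentum-zero state `Φ` with
`⟨Φ, HΦ⟩ ≤ E₀ + d` has `n_k(Φ) ≤ B`, and the orthogonal complement of the centre-of-mass projection has the gap `g`,
then every state `Ψ` with `⟨Ψ, HΨ⟩ ≤ E₀ + δ` has `n_k(Ψ) ≤ 2B`, provided `2δ ≤ d`, `4δ ≤ g` and `6(n+1)δ ≤ gB`.
[folklore] -/
theorem occupation_le_of_momentumZero (v : ℝ → ℝ≥0∞) (hw : Measurable v) (hL : 0 < L)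
    (hE : periodicGroundStateEnergy v (n + 1) L ≠ ⊤) {g : ℝ≥0∞} (hgtop : g ≠ ⊤)
    (hgap : ∀ Ψ : Config (n + 1) → ℂ, IsCore L Ψ →
      (periodicGroundStateEnergy v (n + 1) L + g) * normSq L (fun X => Ψ X - comProj L Ψ X) ≤
        qform v L (fun X => Ψ X - comProj L Ψ X))
    (k : Fin 3 → ℤ) {d B δ : ℝ} (hd : 0 < d) (hB : 0 ≤ B) (hδ : 0 < δ) (hδd : 2 * δ ≤ d)
    (hδg : 4 * δ ≤ g.toReal) (hδB : 6 * ((n : ℝ) + 1) * δ ≤ g.toReal * B)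
    (H0 : ∀ Φ : PeriodicTrialState (n + 1) L,
      periodicEnergy v Φ ≤ periodicGroundStateEnergy v (n + 1) L + ENNReal.ofReal d →
        HasTotalMomentum 0 Φ.ψ → cellOccupation (n + 1) L (planeWaveMode L k) Φ.ψ ≤ ENNReal.ofReal B)
    (Ψ : PeriodicTrialState (n + 1) L)
    (hΨ : periodicEnergy v Ψ ≤ periodicGroundStateEnergy v (n + 1) L + ENNReal.ofReal δ) :
    cellOccupation (n + 1) L (planeWaveMode L k) Ψ.ψ ≤ ENNReal.ofReal (2 * B) := by
  set E₀ : ℝ≥0∞ := periodicGroundStateEnergy v (n + 1) L with hE₀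
  set gR : ℝ := g.toReal with hgR
  have hgR0 : 0 < gR := by linarith
  -- the state, its c.o.m. projection `Φ` and the orthogonal part `Ψp`
  set ψ : Config (n + 1) → ℂ := Ψ.ψ with hψdef
  have hψc : IsCore L ψ := isCore_trialState Ψ
  have hψ1 : normSq L ψ = 1 := Ψ.norm_eq
  have hψE : qform v L ψ ≤ E₀ + ENNReal.ofReal δ := hΨ
  set Φ : Config (n + 1) → ℂ := comProj L ψ with hΦdef
  have hΦcm : IsCore L Φ ∧ HasTotalMomentum 0 Φ := isCore_comProj hL hψc
  obtain ⟨hΦc, hΦ0⟩ := hΦcm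
  set Ψp : Config (n + 1) → ℂ := fun X => ψ X - Φ X with hΨpdef
  have hΨpc : IsCore L Ψp := isCore_sub' hψc hΦc
  have hPy : normSq L ψ = normSq L Φ + normSq L Ψp ∧ qform v L ψ = qform v L Φ + qform v L Ψp :=
    comProj_pythagoras hL hw hψc
  obtain ⟨hPyN, hPyQ⟩ := hPy
  have hgapP : (E₀ + g) * normSq L Ψp ≤ qform v L Ψp := hgap ψ hψc
  have hA1Φ : E₀ * normSq L Φ ≤ qform v L Φ := groundStateEnergy_mul_normSq_le hL hw hΦc
  -- finiteness
  have hEδtop : E₀ + ENNReal.ofReal δ ≠ ⊤ := ENNReal.add_ne_top.2 ⟨hE, ENNReal.ofReal_ne_top⟩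
  have hψEtop : qform v L ψ ≠ ⊤ := ne_top_of_le_ne_top hEδtop hψE
  have hΦEtop : qform v L Φ ≠ ⊤ := ne_top_of_le_ne_top hψEtop (by rw [hPyQ]; exact le_self_add)
  have hΨpEtop : qform v L Ψp ≠ ⊤ := ne_top_of_le_ne_top hψEtop (by rw [hPyQ]; exact le_add_self)
  have hnΦle : normSq L Φ ≤ 1 := by rw [← hψ1, hPyN]; exact le_self_add
  have hnPle : normSq L Ψp ≤ 1 := by rw [← hψ1, hPyN]; exact le_add_self
  have hnΦtop : normSq L Φ ≠ ⊤ := ne_top_of_le_ne_top ENNReal.one_ne_top hnΦle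
  have hnPtop : normSq L Ψp ≠ ⊤ := ne_top_of_le_ne_top ENNReal.one_ne_top hnPle
  -- reals: the near-minimiser splits
  set e0 : ℝ := E₀.toReal with he0
  set nΦ : ℝ := (normSq L Φ).toReal with hnΦ
  set nP : ℝ := (normSq L Ψp).toReal with hnP
  set qΦ : ℝ := (qform v L Φ).toReal with hqΦ
  set qP : ℝ := (qform v L Ψp).toReal with hqP
  have he0_0 : 0 ≤ e0 := ENNReal.toReal_nonneg
  have hnΦ0 : 0 ≤ nΦ := ENNReal.toReal_nonneg
  have hnP0 : 0 ≤ nP := ENNReal.toReal_nonneg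
  have hsumN : nΦ + nP = 1 := by
    have h := congrArg ENNReal.toReal hPyN
    rw [hψ1, ENNReal.toReal_add hnΦtop hnPtop, ENNReal.toReal_one] at h
    linarith
  have hsumQ : qΦ + qP ≤ e0 + δ := by
    have h := ENNReal.toReal_mono hEδtop hψE
    rwa [hPyQ, ENNReal.toReal_add hΦEtop hΨpEtop, ENNReal.toReal_add hE ENNReal.ofReal_ne_top,
      ENNReal.toReal_ofReal hδ.le] at h
  have hA1r : e0 * nΦ ≤ qΦ := by
    have h := ENNReal.toReal_mono hΦEtop hA1Φ
    rwa [ENNReal.toReal_mul] at h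
  have hgapr : (e0 + gR) * nP ≤ qP := by
    have h := ENNReal.toReal_mono hΨpEtop hgapP
    rwa [ENNReal.toReal_mul, ENNReal.toReal_add hE hgtop] at h
  have he0split : e0 = e0 * nΦ + e0 * nP := by rw [← mul_add, hsumN, mul_one]
  have hgsplit : (e0 + gR) * nP = e0 * nP + gR * nP := by ring
  have hgnP0 : 0 ≤ gR * nP := by positivity
  have hnPδ : gR * nP ≤ δ := by linarith
  have h5 : qΦ ≤ e0 * nΦ + δ := by linarith
  -- `nP ≤ 1/4`, hence `nΦ ≥ 3/4 > 0`
  have hnP4 : nP ≤ 1 / 4 := by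
    have h4 : gR * (4 * nP) ≤ gR * 1 := by linarith
    have := le_of_mul_le_mul_left h4 hgR0
    linarith
  have hnΦ34 : 3 / 4 ≤ nΦ := by linarith
  have hnΦpos : 0 < nΦ := by linarith
  have hnΦ0' : normSq L Φ ≠ 0 := fun h0 => hnΦpos.ne' (by rw [hnΦ, h0, ENNReal.toReal_zero])
  -- the normalised projection `Φ/‖Φ‖` is a momentum-zero near-minimiser with slack `d`
  set Φn : PeriodicTrialState (n + 1) L := hΦc.toTrialState hnΦ0' hnΦtop with hΦn
  have hΦnψ : Φn.ψ = fun X => ((Real.sqrt nΦ)⁻¹ : ℂ) * Φ X := hΦc.toTrialState_ψ hnΦ0' hnΦtop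
  have hc2 : ((‖((Real.sqrt nΦ)⁻¹ : ℂ)‖₊ : ℝ≥0∞)) ^ 2 = (normSq L Φ)⁻¹ := by
    rw [coe_nnnorm_sq_eq_ofReal, norm_inv, Complex.norm_real, Real.norm_of_nonneg (Real.sqrt_nonneg _),
      inv_pow, Real.sq_sqrt hnΦ0, ENNReal.ofReal_inv_of_pos hnΦpos, hnΦ, ENNReal.ofReal_toReal hnΦtop]
  have hΦnE : periodicEnergy v Φn ≤ E₀ + ENNReal.ofReal d := by
    rw [hΦc.periodicEnergy_toTrialState v hnΦ0' hnΦtop]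
    have h1 : (normSq L Φ)⁻¹ * qform v L Φ = ENNReal.ofReal (nΦ⁻¹ * qΦ) := by
      rw [ENNReal.ofReal_mul (inv_nonneg.2 hnΦ0), ENNReal.ofReal_inv_of_pos hnΦpos, hnΦ, hqΦ,
        ENNReal.ofReal_toReal hnΦtop, ENNReal.ofReal_toReal hΦEtop]
    have h2 : E₀ + ENNReal.ofReal d = ENNReal.ofReal (e0 + d) := by
      rw [ENNReal.ofReal_add he0_0 hd.le, he0, ENNReal.ofReal_toReal hE]
    rw [h1, h2]
    refine ENNReal.ofReal_le_ofReal ?_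
    rw [inv_mul_le_iff₀ hnΦpos]
    have h3 : d * (3 / 4) ≤ d * nΦ := mul_le_mul_of_nonneg_left hnΦ34 hd.le
    linarith
  have hΦn0 : HasTotalMomentum 0 Φn.ψ := by rw [hΦnψ]; exact hΦ0.const_mul _
  -- the occupations of `Φ` and `Ψp`
  set νE : ℝ≥0∞ := cellOccupation (n + 1) L (planeWaveMode L k) Φ with hνE
  set mE : ℝ≥0∞ := cellOccupation (n + 1) L (planeWaveMode L k) Ψp with hmE
  have hνΦn : (normSq L Φ)⁻¹ * νE ≤ ENNReal.ofReal B := by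
    have h := H0 Φn hΦnE hΦn0
    rwa [hΦnψ, cellOccupation_const_mul, hc2] at h
  have hνle1 : νE ≤ ENNReal.ofReal B := by
    calc νE = normSq L Φ * ((normSq L Φ)⁻¹ * νE) := by
          rw [← mul_assoc, ENNReal.mul_inv_cancel hnΦ0' hnΦtop, one_mul]
      _ ≤ 1 * ENNReal.ofReal B := mul_le_mul' hnΦle hνΦn
      _ = ENNReal.ofReal B := one_mul _
  have hmle : mE ≤ ((n + 1 : ℕ) : ℝ≥0∞) * normSq L Ψp :=
    cellOccupation_le_mul_normSq hL k hΨpc.contDiff.continuous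
  have hνtop : νE ≠ ⊤ := ne_top_of_le_ne_top ENNReal.ofReal_ne_top hνle1
  have hmtop : mE ≠ ⊤ := ne_top_of_le_ne_top (ENNReal.mul_ne_top (ENNReal.natCast_ne_top _) hnPtop) hmle
  set ν : ℝ := νE.toReal with hν
  set m : ℝ := mE.toReal with hm
  have hν0 : 0 ≤ ν := ENNReal.toReal_nonneg
  have hm0 : 0 ≤ m := ENNReal.toReal_nonneg
  have hνB : ν ≤ B := by
    have h := ENNReal.toReal_mono ENNReal.ofReal_ne_top hνle1
    rwa [ENNReal.toReal_ofReal hB] at h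
  have hmr : m ≤ (n + 1) * nP := by
    have h := ENNReal.toReal_mono (ENNReal.mul_ne_top (ENNReal.natCast_ne_top _) hnPtop) hmle
    rw [ENNReal.toReal_mul, ENNReal.toReal_natCast] at h
    push_cast at h
    exact h
  have hm6 : 6 * m ≤ B := by
    have h1 : gR * (6 * m) ≤ gR * (6 * ((n + 1) * nP)) :=
      mul_le_mul_of_nonneg_left (by linarith) hgR0.le
    have h2 : gR * (6 * ((n + 1) * nP)) = 6 * ((n : ℝ) + 1) * (gR * nP) := by ring
    have h3 : 6 * ((n : ℝ) + 1) * (gR * nP) ≤ 6 * ((n : ℝ) + 1) * δ :=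
      mul_le_mul_of_nonneg_left hnPδ (by positivity)
    have h4 : gR * (6 * m) ≤ gR * B := by linarith
    exact le_of_mul_le_mul_left h4 hgR0
  -- Minkowski: `n_k(ψ) ≤ (√ν + √m)²`
  have hB5' : ∀ f : Config (n + 1) → ℂ,
      cellOccupation (n + 1) L (planeWaveMode L k) f = normSq L (modeAn L (planeWaveMode L k) f) :=
    fun f => (normSq_modeAn hL k f).symm
  have hocc : cellOccupation (n + 1) L (planeWaveMode L k) ψ ≤
      (νE ^ (1 / 2 : ℝ) + mE ^ (1 / 2 : ℝ)) ^ (2 : ℝ) := by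
    have h := modeAn_add_real_smul L k hΦc.contDiff.continuous hΨpc.contDiff.continuous 1
    have hψeq : (fun X => Φ X + ((1 : ℝ) : ℂ) * Ψp X) = ψ := by
      funext X; simp only [hΨpdef]; push_cast; ring
    rw [hψeq] at h
    rw [hB5' ψ, hνE, hmE, hB5' Φ, hB5' Ψp, h]
    simp only [Complex.ofReal_one, one_mul]
    exact normSq_add_le_sq L (isCore_modeAn hL k hΦc).contDiff.continuous.measurable
      (isCore_modeAn hL k hΨpc).contDiff.continuous.measurable
  -- conclusion
  calc cellOccupation (n + 1) L (planeWaveMode L k) ψ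
      ≤ (νE ^ (1 / 2 : ℝ) + mE ^ (1 / 2 : ℝ)) ^ (2 : ℝ) := hocc
    _ = ENNReal.ofReal ((Real.sqrt ν + Real.sqrt m) ^ 2) := rpow_half_add_sq_eq hνtop hmtop
    _ ≤ ENNReal.ofReal (2 * B) := by
      refine ENNReal.ofReal_le_ofReal ?_
      have hsν := Real.sq_sqrt hν0
      have hsm := Real.sq_sqrt hm0
      nlinarith [sq_nonneg (Real.sqrt ν - 2 * Real.sqrt m), hsν, hsm, hνB, hm6,
        Real.sqrt_nonneg ν, Real.sqrt_nonneg m]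

end MomentumZero

/-- **Stub `stub_momentumZeroReduction` of the line `two-sector-gd-transfer` (v8), NORMAL FORM**: for an integrable
admissible `v`, the crux's infrared inequality for near-minimisers of TOTAL MOMENTUM ZERO (constant `C`) implies it
for all near-minimisers (constant `2C`): `IRBoundWith v κ ρ₀ (2C)`. [folklore] -/
theorem stub_momentumZeroReduction : ∀ (v : ℝ → ℝ≥0∞), IsRepulsiveFiniteRange v → (∫⁻ x : Space, v ‖x‖) ≠ ⊤ →
    ∀ (κ ρ₀ C : ℝ), 0 < κ → 0 < C →
    (∀ ρ : ℝ, 0 < ρ → ρ < ρ₀ → ∀ᶠ N : ℕ in atTop, ∃ δ : ℝ≥0∞, 0 < δ ∧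
      ∀ Ψ : PeriodicTrialState N (sideLength ρ N), NearMin v ρ N δ Ψ → HasTotalMomentum 0 Ψ.ψ →
        ∀ k : Fin 3 → ℤ, InWindow κ ρ N k → IRIneq C ρ N Ψ.ψ k) →
    IRBoundWith v κ ρ₀ (2 * C) := by
  intro v hv hint κ ρ₀ C hκ hC hyp ρ hρ hρ₀
  filter_upwards [hyp ρ hρ hρ₀, eventually_ge_atTop 1] with N hN hN1
  obtain ⟨δ₀, hδ₀, hN⟩ := hN
  obtain ⟨n, rfl⟩ : ∃ n, N = n + 1 := ⟨N - 1, by omega⟩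
  have hw : Measurable v := hv.1
  have hL : 0 < sideLength ρ (n + 1) := sideLength_pos_of_pos hρ (Nat.succ_pos n)
  have hE : periodicGroundStateEnergy v (n + 1) (sideLength ρ (n + 1)) ≠ ⊤ :=
    periodicGroundStateEnergy_integrable_ne_top hL hw hint (n + 1)
  obtain ⟨g, hg0, hgapΨ⟩ := exists_gap_comProj hL hw hint (M := n + 1) (by omega) hE
    (zeroMomentumGapFor_of_integrable hv hint (n + 1) _ hL)
  -- cap the gap and the momentum-zero slack at `1`
  set gm : ℝ≥0∞ := min g 1 with hgm
  have hgm0 : 0 < gm := lt_min hg0 one_pos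
  have hgmtop : gm ≠ ⊤ := ne_top_of_le_ne_top ENNReal.one_ne_top (min_le_right _ _)
  have hgR0 : 0 < gm.toReal := ENNReal.toReal_pos hgm0.ne' hgmtop
  have hgapm : ∀ Ψ : Config (n + 1) → ℂ, IsCore (sideLength ρ (n + 1)) Ψ →
      (periodicGroundStateEnergy v (n + 1) (sideLength ρ (n + 1)) + gm) *
          normSq (sideLength ρ (n + 1)) (fun X => Ψ X - comProj (sideLength ρ (n + 1)) Ψ X) ≤
        qform v (sideLength ρ (n + 1)) (fun X => Ψ X - comProj (sideLength ρ (n + 1)) Ψ X) :=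
    fun Ψ hΨ => le_trans (by gcongr; exact min_le_left g 1) (hgapΨ Ψ hΨ)
  set dm : ℝ≥0∞ := min δ₀ 1 with hdm
  have hdm0 : 0 < dm := lt_min hδ₀ one_pos
  have hdmtop : dm ≠ ⊤ := ne_top_of_le_ne_top ENNReal.one_ne_top (min_le_right _ _)
  have hd0 : 0 < dm.toReal := ENNReal.toReal_pos hdm0.ne' hdmtop
  -- the slack
  set δ₁ : ℝ := gm.toReal * C / (6 * κ * (n + 1)) with hδ₁
  have hδ₁0 : 0 < δ₁ := by positivity
  set δR : ℝ := min (min (dm.toReal / 2) (gm.toReal / 4)) δ₁ with hδR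
  have hδR0 : 0 < δR := lt_min (lt_min (by positivity) (by positivity)) hδ₁0
  have hδR1 : δR ≤ dm.toReal / 2 := (min_le_left _ _).trans (min_le_left _ _)
  have hδR2 : δR ≤ gm.toReal / 4 := (min_le_left _ _).trans (min_le_right _ _)
  have hδR3 : δR ≤ δ₁ := min_le_right _ _
  refine ⟨ENNReal.ofReal δR, ENNReal.ofReal_pos.2 hδR0, fun Ψ hΨ k hk => ?_⟩
  -- the window: `‖k‖ > 0` and `1/κ ≤ √ρ L/‖k‖`
  have hK0 : (fun j => (k j : ℝ)) ≠ 0 := fun h => hk.1 (funext fun j => by simpa using congrFun h j)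
  have hKpos : 0 < ‖(fun j => (k j : ℝ))‖ := norm_pos_iff.2 hK0
  set K : ℝ := ‖(fun j => (k j : ℝ))‖ with hK
  set B : ℝ := C * Real.sqrt ρ * sideLength ρ (n + 1) / K with hB
  have hB0 : 0 ≤ B := by positivity
  have hXκ : 1 / κ ≤ Real.sqrt ρ * sideLength ρ (n + 1) / K := by
    rw [div_le_div_iff₀ hκ hKpos, one_mul]
    calc K ≤ κ * Real.sqrt ρ * sideLength ρ (n + 1) := hk.2
      _ = Real.sqrt ρ * sideLength ρ (n + 1) * κ := by ring
  have hδB : 6 * ((n : ℝ) + 1) * δR ≤ gm.toReal * B := by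
    have h1 : 6 * ((n : ℝ) + 1) * δR ≤ 6 * ((n : ℝ) + 1) * δ₁ :=
      mul_le_mul_of_nonneg_left hδR3 (by positivity)
    have h2 : 6 * ((n : ℝ) + 1) * δ₁ = gm.toReal * C * (1 / κ) := by
      rw [hδ₁]
      field_simp
    have h3 : gm.toReal * C * (1 / κ) ≤ gm.toReal * C * (Real.sqrt ρ * sideLength ρ (n + 1) / K) :=
      mul_le_mul_of_nonneg_left hXκ (by positivity)
    have h4 : gm.toReal * C * (Real.sqrt ρ * sideLength ρ (n + 1) / K) = gm.toReal * B := by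
      rw [hB]; ring
    linarith
  have H0 : ∀ Φ : PeriodicTrialState (n + 1) (sideLength ρ (n + 1)),
      periodicEnergy v Φ ≤ periodicGroundStateEnergy v (n + 1) (sideLength ρ (n + 1)) + ENNReal.ofReal dm.toReal →
        HasTotalMomentum 0 Φ.ψ →
          cellOccupation (n + 1) (sideLength ρ (n + 1)) (planeWaveMode (sideLength ρ (n + 1)) k) Φ.ψ ≤
            ENNReal.ofReal B := by
    intro Φ hΦE hΦ0
    have hnear : NearMin v ρ (n + 1) δ₀ Φ := by
      refine hΦE.trans (add_le_add le_rfl ?_)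
      rw [ENNReal.ofReal_toReal hdmtop]
      exact min_le_left _ _
    exact (irIneq_iff C ρ (n + 1) Φ.ψ k).1 (hN Φ hnear hΦ0 k hk)
  have hmain := MomentumZero.occupation_le_of_momentumZero v hw hL hE hgmtop hgapm k hd0 hB0 hδR0
    (by linarith) (by linarith) hδB H0 Ψ hΨ
  rw [irIneq_iff]
  have h2B : 2 * C * Real.sqrt ρ * sideLength ρ (n + 1) / K = 2 * B := by rw [hB]; ring
  rw [h2B]
  exact hmain

end Summit.AtomisticToContinuum.BoseEinsteinCondensation.Cruxes.PeriodicIRBound.TwoSectorGdTransfer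

end
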